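import Mathlib

/-!
# Independent sets of Hoffman order in the Erdős–Rényi orthogonal polarity graph over a PRIME field
(Mubayi–Williford 2007, Theorem 5, case `q = p`)

The Erdős–Rényi graph `ER_q` has the points of `PG(2,q)` as vertices, `x ∼ y` iff `x ⬝ y = 0`
(orthogonal polarity); the Hoffman bound gives `α(ER_q) ≤ q^{3/2} + q + 1`.  Mubayi–Williford proved
that this is the right order for EVERY `q`, in particular for primes, where no subfield is available:
in the model `ER_q^*` (polarity of the form `x₀y₂ − x₁y₁ + x₂y₀`, Prop. 3 of the source) the affine
vertices `(1, t, s)` are adjacent iff `s + s' = t·t'` (Prop. 4: the graph `G_{q,2}`), and for a prime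
`p` the box `t ∈ [1, √(p/3)]`, `s ∈ (p/6, p/2)` is independent because `3(s+s') > p > 3tt'` holds over
the integers and both sides are `< p` (case (ii) of the proof of Thm. 5 with `n = 1`): an independent
set (without absolute points) of size `≈ p^{3/2}/(3√3)`.

* `erdosRenyiStar_independent_box` — the box, its exact size `((p−1)/2 − p/6)·⌊√((p−1)/3)⌋` and its
  independence (incl. no loops), for every odd prime `p`;
* `erdosRenyiStar_independent_prime` — the asymptotic form: `|X| ≥ p^{3/2}/8` for all primes `p ≥ 48`.

Why it is recorded here (wall `stub_tangencySets` of crux `LevelOneGL2Designs`, Hermitian-unital axis):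
for the POLARITY graph the square-root barrier over prime fields is broken by intervals because the
adjacency `s + s' = tt'` is a SUM relation confined to an integer window; the tangency/induced-matching
problem `IM(2,p)` (a DIFFERENCE relation with a forced diagonal incidence) has no such escape and is
open at exponent `3/2` (HPVZ arXiv:2601.19879 §10, Pohoata arXiv:2607.20422).
Elementary (`Nat.sqrt`, casts into `ZMod p`); no new definitions.
-/

namespace Literature.Combinatorics.Extremal

open Finset

/-- Casting naturals below `p` into `ZMod p` is injective. [folklore] -/
theorem natCast_zmod_eq_of_lt {p a b : ℕ} (ha : a < p) (hb : b < p) (h : (a : ZMod p) = (b : ZMod p)) :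
    a = b := by
  have := (ZMod.natCast_eq_natCast_iff' a b p).mp h
  rwa [Nat.mod_eq_of_lt ha, Nat.mod_eq_of_lt hb] at this

/-- **Mubayi–Williford 2007, Thm. 5 (prime case), the box.**  For an odd prime `p` let
`S = [p/6 + 1, (p−1)/2]`, `T = [1, m]` with `m = ⌊√((p−1)/3)⌋`.  The `|S|·|T|` vertices `(t, s)`
(standing for the points `(1 : t : s)` of `PG(2,p)`) are pairwise — and self- — non-adjacent in the
Erdős–Rényi polarity graph `ER_p^*`, whose adjacency on these vertices is `s + s' = t·t'`
(Mubayi–Williford Prop. 4): as integers `3(s+s') > p ≥ 3m² ≥ 3tt'`, and both `s+s'` and `tt'` are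
`< p`. [cite: MubayiWilliford2007IndependenceNumberErdosRenyi, Thm. 5 (ii) with n = 1, Prop. 4] -/
theorem erdosRenyiStar_independent_box (p : ℕ) [hp : Fact p.Prime] (hp2 : p ≠ 2) :
    ∃ X : Finset (ZMod p × ZMod p),
      X.card = ((p - 1) / 2 - p / 6) * Nat.sqrt ((p - 1) / 3) ∧
      ∀ x ∈ X, ∀ y ∈ X, x.2 + y.2 ≠ x.1 * y.1 := by
  classical
  have hp1 : 2 < p := lt_of_le_of_ne hp.out.two_le (Ne.symm hp2)
  have hodd : p % 2 = 1 := (hp.out.eq_two_or_odd).resolve_left hp2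
  set a := p / 6 + 1 with ha
  set b := (p - 1) / 2 with hb
  set m := Nat.sqrt ((p - 1) / 3) with hm
  let S : Finset ℕ := Finset.Icc a b
  let T : Finset ℕ := Finset.Icc 1 m
  let φ : ℕ × ℕ → ZMod p × ZMod p := fun st => ((st.2 : ZMod p), (st.1 : ZMod p))
  -- ranges
  have hbp : b < p := by omega
  have hm2 : 3 * (m * m) ≤ p - 1 := by
    have := Nat.sqrt_le ((p - 1) / 3)
    rw [← hm] at this
    omega
  have hmp : m < p := by
    have h1 : m ≤ m * m := by
      rcases Nat.eq_zero_or_pos m with h | h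
      · simp [h]
      · exact Nat.le_mul_of_pos_left m h
    omega
  have hSlt : ∀ s ∈ S, s < p := fun s hs => (Finset.mem_Icc.mp hs).2.trans_lt hbp
  have hTlt : ∀ t ∈ T, t < p := fun t ht => (Finset.mem_Icc.mp ht).2.trans_lt hmp
  have hinj : Set.InjOn φ (S ×ˢ T : Finset (ℕ × ℕ)) := by
    rintro ⟨s, t⟩ hst ⟨s', t'⟩ hst' h
    simp only [Finset.coe_product, Set.mem_prod, Finset.mem_coe] at hst hst'
    simp only [φ, Prod.mk.injEq] at h
    obtain ⟨h1, h2⟩ := h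
    have := natCast_zmod_eq_of_lt (hTlt _ hst.2) (hTlt _ hst'.2) h1
    have := natCast_zmod_eq_of_lt (hSlt _ hst.1) (hSlt _ hst'.1) h2
    simp_all
  refine ⟨(S ×ˢ T).image φ, ?_, ?_⟩
  · rw [Finset.card_image_of_injOn hinj, Finset.card_product]
    simp [S, T, Nat.card_Icc]
    omega
  · intro x hx y hy hxy
    rw [Finset.mem_image] at hx hy
    obtain ⟨⟨s, t⟩, hst, rfl⟩ := hx
    obtain ⟨⟨s', t'⟩, hst', rfl⟩ := hy
    rw [Finset.mem_product] at hst hst'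
    obtain ⟨hs, ht⟩ := hst
    obtain ⟨hs', ht'⟩ := hst'
    rw [Finset.mem_Icc] at hs ht hs' ht'
    simp only [φ] at hxy
    -- `(s + s' : ℕ) = (t * t' : ℕ)` in `ZMod p`, hence in `ℕ`
    have hcast : ((s + s' : ℕ) : ZMod p) = ((t * t' : ℕ) : ZMod p) := by push_cast; exact hxy
    have hss : s + s' < p := by omega
    have htt : t * t' ≤ m * m := Nat.mul_le_mul ht.2 ht'.2
    have httm : t * t' < p := by omega
    have heq : s + s' = t * t' := natCast_zmod_eq_of_lt hss httm hcast
    -- but `3 (s + s') > p ≥ 3 t t'`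
    have h6 : 6 * (p / 6) + 6 > p := by omega
    omega

/-- **Mubayi–Williford 2007, Thm. 5 (prime case), asymptotic form.**  For every prime `p ≥ 48` the
Erdős–Rényi polarity graph `ER_p^*` (vertices `(t,s) ↔ (1:t:s)`, adjacency `s + s' = tt'`) has an
independent set without absolute points of size at least `p^{3/2}/8` — the Hoffman order of magnitude,
over a PRIME field, by an interval construction.
[cite: MubayiWilliford2007IndependenceNumberErdosRenyi, Thm. 5] -/
theorem erdosRenyiStar_independent_prime (p : ℕ) [hp : Fact p.Prime] (h48 : 48 ≤ p) :
    ∃ X : Finset (ZMod p × ZMod p),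
      (1 : ℝ) / 8 * (p : ℝ) ^ (3 / 2 : ℝ) ≤ X.card ∧
      ∀ x ∈ X, ∀ y ∈ X, x.2 + y.2 ≠ x.1 * y.1 := by
  have hp2 : p ≠ 2 := by omega
  obtain ⟨X, hcard, hX⟩ := erdosRenyiStar_independent_box p hp2
  refine ⟨X, ?_, hX⟩
  rw [hcard]
  have hodd : p % 2 = 1 := (hp.out.eq_two_or_odd).resolve_left hp2
  set m := Nat.sqrt ((p - 1) / 3) with hm
  -- integer facts
  have hS : 3 * ((p - 1) / 2 - p / 6) + 2 ≥ p := by omega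
  have hm1 : (p - 1) / 3 < (m + 1) * (m + 1) := by
    have := Nat.lt_succ_sqrt ((p - 1) / 3)
    rw [← hm] at this
    simpa [Nat.succ_eq_add_one] using this
  have hm3 : p ≤ 3 * ((m + 1) * (m + 1)) := by omega
  have hm4 : 4 ≤ m := by
    by_contra h
    push Not at h
    have : (m + 1) * (m + 1) ≤ 16 := by nlinarith
    omega
  -- real estimates: with `A = (p-1)/2 - p/6` and `m`: `3A + 2 ≥ p`, `3(m+1)² ≥ p`, `m ≥ 4`
  set A := (p - 1) / 2 - p / 6 with hA
  have hAr : (p : ℝ) ≤ 3 * A + 2 := by exact_mod_cast hS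
  have hmr : (p : ℝ) ≤ 3 * ((m : ℝ) + 1) ^ 2 := by exact_mod_cast (by nlinarith [hm3] : p ≤ 3 * (m + 1) ^ 2)
  have hm4r : (4 : ℝ) ≤ m := by exact_mod_cast hm4
  have hp0 : (0 : ℝ) ≤ p := by positivity
  -- `p^{3/2} = p · √p` and `√p ≤ √3 · (m+1) ≤ (7/4)(m+1)`
  have hsplit : (p : ℝ) ^ (3 / 2 : ℝ) = p * Real.sqrt p := by
    rw [show (3 / 2 : ℝ) = 1 + 1 / 2 by norm_num,
      Real.rpow_add' hp0 (by norm_num), Real.rpow_one, Real.sqrt_eq_rpow]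
  have hsqrt : Real.sqrt p ≤ 7 / 4 * ((m : ℝ) + 1) := by
    rw [Real.sqrt_le_left (by positivity)]
    nlinarith [hmr]
  rw [hsplit]
  push_cast
  have hA15 : (15 : ℝ) ≤ A := by
    have : (48 : ℝ) ≤ p := by exact_mod_cast h48
    linarith
  have hm0 : (0 : ℝ) ≤ m := by positivity
  have hkey : (p : ℝ) * (7 / 4 * ((m : ℝ) + 1)) ≤ 8 * ((A : ℝ) * m) := by
    have h1 : (p : ℝ) * (7 / 4 * ((m : ℝ) + 1)) ≤ (3 * A + 2) * (7 / 4 * ((m : ℝ) + 1)) := by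
      gcongr
    have h2 : (3 * (A : ℝ) + 2) * (7 / 4 * ((m : ℝ) + 1)) ≤ 8 * ((A : ℝ) * m) := by
      nlinarith [mul_nonneg (sub_nonneg.2 hm4r) (by linarith : (0 : ℝ) ≤ A),
        mul_nonneg (sub_nonneg.2 hA15) hm0]
    exact h1.trans h2
  calc 1 / 8 * ((p : ℝ) * Real.sqrt p) ≤ 1 / 8 * ((p : ℝ) * (7 / 4 * ((m : ℝ) + 1))) := by
        gcongr
    _ ≤ (A : ℝ) * m := by linarith

end Literature.Combinatorics.Extremal
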